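import Summits.MatrixMultiplication.MatrixMultiplication.Theses.ThinBlockAlpha
import Literature.Computability.AlgebraicComplexity.GroupTheoreticMatMulThmBProofs

/-!
# Packing necessities for the witnesses of `ThinBlockAlpha.ThinPackings` (crux stmt-MatrixMultiplication-10595), I

Negative-side lemmas of the standing disprover (cdisprove), all elementary and sorry-free:

* packing consequences of `IsSTPP` for a family of blocks `⟨N, M, N⟩` in a finite abelian group:
  the two long legs pack (`Σ|Aₖ||Cₖ| ≤ |H|`), a new three-term bound
  `Σ|Aₖ||Cₖ| + Σ|Bⱼ||Cⱼ| − |C_{i₀}| ≤ |H|`, hence `L·N² + (L·M·N − N) ≤ |H|` and `L·N² < |H|`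
  once `M ≥ 2`;
* quantitative necessities for any witness of the crux matrix: `N^{a−η} ≤ L` (many blocks) and
  `M ≤ N·(N^η − 1) + 1` (the short leg is squeezed; `N → ∞` is forced as `η → 0`);
* (sibling file `ThinPackingsStrengtheningsFalse.lean`: four natural strengthenings of the
  crux are FALSE — exact packing `η = 0`, a single block, bounded `N`, bounded exponent.)

None of these refutes the crux (an abelian-STPP barrier in unbounded exponent is open); they are
the prover's briefing on what a witness family must look like.

References: H. Cohn, C. Umans, FOCS 2003 (arXiv:math/0307321) Lemma 3.1; H. Cohn, R. Kleinberg,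
B. Szegedy, C. Umans, FOCS 2005 (arXiv:math/0511460) Def. 5.1; J. Blasiak, T. Church, H. Cohn,
J. A. Grochow, E. Naslund, W. F. Sawin, C. Umans, Discrete Analysis 2017:3 (arXiv:1605.06702)
§2 (packing bounds), Thm. B.
-/

namespace Summit.MatrixMultiplication.MatrixMultiplication.Theorems.ThinPackings.Negative

open Literature.Computability.AlgebraicComplexity Finset

/-! ## Packing lemmas -/

section Packing

variable {H : Type*} [AddCommGroup H] {L : ℕ} {A B C : Fin L → Finset H}

/-- `(k, s, u') ↦ s − u'` is injective on `⨆ₖ Aₖ × Cₖ` (all `Bₖ` nonempty): the two long legs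
pack.  [folklore; BCCGNSU 2017 §2 packing bound, rotated] -/
theorem injOn_sub_AC (hS : IsSTPP A B C) (hB : ∀ i, (B i).Nonempty) :
    Set.InjOn (fun x : (Σ _ : Fin L, H × H) => x.2.1 - x.2.2)
      ↑(univ.sigma fun k => A k ×ˢ C k) := by
  classical
  rintro ⟨k, s, u'⟩ hx ⟨k₂, s₂, u₂⟩ hy he
  simp only [coe_sigma, Set.mem_sigma_iff, coe_univ, Set.mem_univ, true_and, coe_product,
    Set.mem_prod, mem_coe] at hx hy
  change s - u' = s₂ - u₂ at he
  obtain ⟨b, hb⟩ := hB k₂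
  have h0 : (s₂ - s) + (b - b) + (u' - u₂) = 0 := by
    have : (s₂ - s) + (b - b) + (u' - u₂) = (s₂ - u₂) - (s - u') := by abel
    rw [this, he, sub_self]
  obtain ⟨-, h2, h3, -, h5⟩ := hS k₂ k₂ k s hx.1 s₂ hy.1 b hb b hb u₂ hy.2 u' hx.2 h0
  subst h2 h3 h5
  rfl

/-- `(j, t', u) ↦ t' − u` is injective on `⨆ⱼ Bⱼ × Cⱼ` (all `Aⱼ` nonempty). [folklore] -/
theorem injOn_sub_BC (hS : IsSTPP A B C) (hA : ∀ i, (A i).Nonempty) :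
    Set.InjOn (fun x : (Σ _ : Fin L, H × H) => x.2.1 - x.2.2)
      ↑(univ.sigma fun j => B j ×ˢ C j) := by
  classical
  rintro ⟨j, t', u⟩ hx ⟨j₂, t₂, u₂⟩ hy he
  simp only [coe_sigma, Set.mem_sigma_iff, coe_univ, Set.mem_univ, true_and, coe_product,
    Set.mem_prod, mem_coe] at hx hy
  change t' - u = t₂ - u₂ at he
  obtain ⟨a, ha⟩ := hA j₂
  have h0 : (a - a) + (t' - t₂) + (u₂ - u) = 0 := by
    have : (a - a) + (t' - t₂) + (u₂ - u) = (t' - u) - (t₂ - u₂) := by abel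
    rw [this, he, sub_self]
  obtain ⟨h1, -, -, h4, h5⟩ := hS j₂ j j₂ a ha a ha t₂ hy.1 t' hx.1 u hx.2 u₂ hy.2 h0
  subst h1 h4 h5
  rfl

variable [Fintype H]

/-- Two long legs pack: `Σₖ |Aₖ| |Cₖ| ≤ |H|`. [folklore; BCCGNSU 2017 §2] -/
theorem sum_card_A_mul_card_C_le (hS : IsSTPP A B C) (hB : ∀ i, (B i).Nonempty) :
    ∑ k, (A k).card * (C k).card ≤ Fintype.card H := by
  classical
  calc ∑ k, (A k).card * (C k).card = (univ.sigma fun k => A k ×ˢ C k).card := by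
        rw [card_sigma]; simp only [card_product]
    _ = ((univ.sigma fun k => A k ×ˢ C k).image
          fun x : (Σ _ : Fin L, H × H) => x.2.1 - x.2.2).card :=
        (card_image_of_injOn (injOn_sub_AC hS hB)).symm
    _ ≤ Fintype.card H := card_le_univ _

/-- **Two legs plus a short leg.**  For an STPP family with all `Aᵢ`, `Bᵢ` nonempty and any
index `i₀`: `Σₖ |Aₖ||Cₖ| + (Σⱼ |Bⱼ||Cⱼ| − |C_{i₀}|) ≤ |H|`.
Proof: fix `a ∈ A_{i₀}`, `b ∈ B_{i₀}`; the elements `a − b + t' − u` (`t' ∈ Bⱼ`, `u ∈ Cⱼ`,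
`(j, t') ≠ (i₀, b)`) are pairwise distinct and none of them is of the form `s − u'`
(`s ∈ Aₖ`, `u' ∈ Cₖ`), by the STPP instance `(i₀, j, k)`. [new, elementary] -/
theorem packing_three (hS : IsSTPP A B C) (hA : ∀ i, (A i).Nonempty) (hB : ∀ i, (B i).Nonempty)
    (i₀ : Fin L) :
    ∑ k, (A k).card * (C k).card + (∑ j, (B j).card * (C j).card - (C i₀).card) ≤
      Fintype.card H := by
  classical
  obtain ⟨a, ha⟩ := hA i₀
  obtain ⟨b, hb⟩ := hB i₀
  set DAC : Finset (Σ _ : Fin L, H × H) := univ.sigma fun k => A k ×ˢ C k with hDAC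
  set DBC : Finset (Σ _ : Fin L, H × H) := univ.sigma fun j => B j ×ˢ C j with hDBC
  set f : (Σ _ : Fin L, H × H) → H := fun x => x.2.1 - x.2.2 with hf
  set p : (Σ _ : Fin L, H × H) → Prop := fun y => y.1 = i₀ ∧ y.2.1 = b with hp
  set D' := DBC.filter fun y => ¬ p y with hD'
  set g : (Σ _ : Fin L, H × H) → H := fun y => (a - b) + (y.2.1 - y.2.2) with hg
  set Z := DAC.image f with hZ
  set W := D'.image g with hW
  have hZcard : Z.card = ∑ k, (A k).card * (C k).card := by
    rw [hZ, card_image_of_injOn (injOn_sub_AC hS hB), card_sigma]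
    simp only [card_product]
  have hWcard : W.card = D'.card := by
    rw [hW]
    refine card_image_of_injOn fun x hx y hy hxy => ?_
    have hx' : x ∈ (DBC : Set _) := by
      simp only [mem_coe] at hx ⊢; exact (mem_filter.1 hx).1
    have hy' : y ∈ (DBC : Set _) := by
      simp only [mem_coe] at hy ⊢; exact (mem_filter.1 hy).1
    exact injOn_sub_BC hS hA hx' hy' (add_left_cancel hxy)
  have hDBCcard : DBC.card = ∑ j, (B j).card * (C j).card := by
    rw [hDBC, card_sigma]; simp only [card_product]
  -- the removed fibre `{(i₀, b)} × C i₀` has at most |C i₀| elements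
  have hfib : (DBC.filter p).card ≤ (C i₀).card := by
    calc (DBC.filter p).card
        ≤ ((C i₀).image fun u => (⟨i₀, (b, u)⟩ : Σ _ : Fin L, H × H)).card := by
          refine card_le_card fun y hy => ?_
          obtain ⟨j, t', u⟩ := y
          simp only [hDBC, hp, mem_filter, mem_sigma, mem_univ, true_and, mem_product] at hy
          obtain ⟨⟨-, hc⟩, rfl, rfl⟩ := hy
          exact mem_image.2 ⟨u, hc, rfl⟩
      _ ≤ (C i₀).card := card_image_le
  have hD'card : ∑ j, (B j).card * (C j).card - (C i₀).card ≤ D'.card := by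
    have hsplit := Finset.card_filter_add_card_filter_not (s := DBC) p
    rw [hD']
    omega
  -- Z and W are disjoint: an equality `s − u' = (a − b) + (t' − u)` is an STPP instance (i₀, j, k)
  have hdisj : Disjoint Z W := by
    rw [disjoint_left]
    intro h hZ' hW'
    rw [hZ, mem_image] at hZ'
    rw [hW, mem_image] at hW'
    obtain ⟨⟨k, s, u'⟩, hx, hxe⟩ := hZ'
    obtain ⟨⟨j, t', u⟩, hy, hye⟩ := hW'
    simp only [hDAC, mem_sigma, mem_univ, true_and, mem_product] at hx
    simp only [hD', hDBC, hp, mem_filter, mem_sigma, mem_univ, true_and, mem_product] at hy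
    obtain ⟨⟨ht', hu⟩, hne⟩ := hy
    change s - u' = h at hxe
    change (a - b) + (t' - u) = h at hye
    have h0 : (a - s) + (t' - b) + (u' - u) = 0 := by
      have : (a - s) + (t' - b) + (u' - u) = ((a - b) + (t' - u)) - (s - u') := by abel
      rw [this, hye, hxe, sub_self]
    obtain ⟨h1, -, -, h4, -⟩ := hS i₀ j k s hx.1 a ha b hb t' ht' u hu u' hx.2 h0
    exact hne ⟨h1.symm, h4.symm⟩
  calc ∑ k, (A k).card * (C k).card + (∑ j, (B j).card * (C j).card - (C i₀).card)
      ≤ Z.card + W.card := by rw [hZcard, hWcard]; exact Nat.add_le_add_left hD'card _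
    _ = (Z ∪ W).card := (card_union_of_disjoint hdisj).symm
    _ ≤ Fintype.card H := card_le_univ _

/-- Thin profile `⟨N, M, N⟩`, `L ≥ 1`, `M ≥ 1`: `L·N² + (L·M·N − N) ≤ |H|`. [new, elementary] -/
theorem thin_packing_bound (hS : IsSTPP A B C) {N M : ℕ}
    (hc : ∀ i, (A i).card = N ∧ (B i).card = M ∧ (C i).card = N) (hN : 1 ≤ N) (hM : 1 ≤ M)
    (hL : 1 ≤ L) : L * (N * N) + (L * (M * N) - N) ≤ Fintype.card H := by
  have hA : ∀ i, (A i).Nonempty := fun i => card_pos.1 (by rw [(hc i).1]; exact hN)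
  have hB : ∀ i, (B i).Nonempty := fun i => card_pos.1 (by rw [(hc i).2.1]; exact hM)
  have h := packing_three hS hA hB ⟨0, hL⟩
  have h1 : ∑ k, (A k).card * (C k).card = L * (N * N) := by
    rw [Finset.sum_congr rfl fun k _ => by rw [(hc k).1, (hc k).2.2], sum_const, card_univ,
      Fintype.card_fin, smul_eq_mul]
  have h2 : ∑ j, (B j).card * (C j).card = L * (M * N) := by
    rw [Finset.sum_congr rfl fun j _ => by rw [(hc j).2.1, (hc j).2.2], sum_const, card_univ,
      Fintype.card_fin, smul_eq_mul]
  rw [h1, h2, (hc _).2.2] at h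
  exact h

/-- In particular the two-leg packing is never exact once `M ≥ 2`: `L·N² < |H|`. [new] -/
theorem thin_packing_strict (hS : IsSTPP A B C) {N M : ℕ}
    (hc : ∀ i, (A i).card = N ∧ (B i).card = M ∧ (C i).card = N) (hN : 1 ≤ N) (hM : 2 ≤ M)
    (hL : 1 ≤ L) : L * (N * N) < Fintype.card H := by
  have h := thin_packing_bound hS hc hN (by omega) hL
  have h2 : 1 * (2 * N) ≤ L * (M * N) := Nat.mul_le_mul hL (Nat.mul_le_mul_right N hM)
  omega

/-- Single-block volume bound (Cohn–Umans 2003 Lemma 3.1, via the tree): `N·M·N ≤ |H|`.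
[cite: CohnUmans2003, Lemma 3.1] -/
theorem thin_volume_bound (hS : IsSTPP A B C) {N M : ℕ}
    (hc : ∀ i, (A i).card = N ∧ (B i).card = M ∧ (C i).card = N) (i : Fin L) :
    N * M * N ≤ Fintype.card H := by
  have h := ((isSTPP_iff_addSimultaneousTPP A B C).1 hS).card_mul_card_mul_card_le i
  rw [(hc i).1, (hc i).2.1, (hc i).2.2] at h
  exact h

end Packing

/-! ## Quantitative necessary conditions on a witness of the crux matrix -/

section Quantitative

variable {H : Type} [AddCommGroup H] [Fintype H] {L N M : ℕ} {A B C : Fin L → Finset H}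
  {a η : ℝ}

/-- `N^a ≤ M` with `N ≥ 2`, `a ≥ 0` forces `M ≥ 1` (so the STPP predicate is not vacuous). -/
theorem one_le_M (hN : 2 ≤ N) (ha : 0 ≤ a) (hM : (N : ℝ) ^ a ≤ M) : 1 ≤ M := by
  have h1 : (1 : ℝ) ≤ (N : ℝ) ^ a := Real.one_le_rpow (by exact_mod_cast (by omega : 1 ≤ N)) ha
  exact_mod_cast h1.trans hM

/-- `N^a ≤ M` with `N ≥ 2`, `a > 0` forces `M ≥ 2`. -/
theorem two_le_M (hN : 2 ≤ N) (ha : 0 < a) (hM : (N : ℝ) ^ a ≤ M) : 2 ≤ M := by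
  have h1 : (1 : ℝ) < (N : ℝ) ^ a := Real.one_lt_rpow (by exact_mod_cast (by omega : 1 < N)) ha
  have h2 : (1 : ℝ) < M := h1.trans_le hM
  have h3 : 1 < M := by exact_mod_cast h2
  omega

/-- The size bound forces `L ≥ 1` (`|H| ≥ 1`). -/
theorem one_le_L (hH : (Fintype.card H : ℝ) ≤ L * (N : ℝ) ^ (2 + η)) : 1 ≤ L := by
  by_contra h0
  have hL : L = 0 := by omega
  rw [hL, Nat.cast_zero, zero_mul] at hH
  have : (0 : ℝ) < Fintype.card H := by exact_mod_cast Fintype.card_pos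
  linarith

/-- **Many blocks are needed**: `N^{a-η} ≤ L` (single-block volume `N²M ≤ |H|`).  In particular a
single TPP triple (`L = 1`) can only serve `a ≤ η`. [new, elementary] -/
theorem rpow_sub_le_L (hS : IsSTPP A B C)
    (hc : ∀ i, (A i).card = N ∧ (B i).card = M ∧ (C i).card = N) (hN : 2 ≤ N)
    (hM : (N : ℝ) ^ a ≤ M) (hH : (Fintype.card H : ℝ) ≤ L * (N : ℝ) ^ (2 + η)) :
    (N : ℝ) ^ (a - η) ≤ L := by
  have hL := one_le_L hH
  have hvol := thin_volume_bound hS hc ⟨0, hL⟩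
  have hNpos : (0 : ℝ) < N := by exact_mod_cast (by omega : 0 < N)
  have hvol' : ((N * M * N : ℕ) : ℝ) ≤ Fintype.card H := by exact_mod_cast hvol
  have h1 : (N : ℝ) ^ (2 : ℝ) * (N : ℝ) ^ a ≤ (N : ℝ) ^ (2 : ℝ) * (L * (N : ℝ) ^ η) := by
    calc (N : ℝ) ^ (2 : ℝ) * (N : ℝ) ^ a = (N : ℝ) * N * (N : ℝ) ^ a := by rw [Real.rpow_two]; ring
      _ ≤ (N : ℝ) * N * M := by gcongr
      _ = ((N * M * N : ℕ) : ℝ) := by push_cast; ring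
      _ ≤ Fintype.card H := hvol'
      _ ≤ L * (N : ℝ) ^ (2 + η) := hH
      _ = (N : ℝ) ^ (2 : ℝ) * (L * (N : ℝ) ^ η) := by rw [Real.rpow_add hNpos]; ring
  have h2 : (N : ℝ) ^ a ≤ L * (N : ℝ) ^ η := le_of_mul_le_mul_left h1 (by positivity)
  calc (N : ℝ) ^ (a - η) = (N : ℝ) ^ a / (N : ℝ) ^ η := Real.rpow_sub hNpos a η
    _ ≤ L := by rw [div_le_iff₀ (by positivity)]; exact h2

/-- **The short leg is squeezed**: `M ≤ N·(N^η − 1) + 1` (from `L·N² + L·M·N − N ≤ |H|`).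
So as `η → 0` with `N` bounded nothing survives, and in general `N^η ≥ 1 + (M-1)/N`.
[new, elementary] -/
theorem M_le (hS : IsSTPP A B C)
    (hc : ∀ i, (A i).card = N ∧ (B i).card = M ∧ (C i).card = N) (hN : 2 ≤ N) (ha : 0 ≤ a)
    (hM : (N : ℝ) ^ a ≤ M) (hH : (Fintype.card H : ℝ) ≤ L * (N : ℝ) ^ (2 + η)) :
    (M : ℝ) ≤ N * ((N : ℝ) ^ η - 1) + 1 := by
  have hL := one_le_L hH
  have hM1 := one_le_M hN ha hM
  have hpk := thin_packing_bound hS hc (by omega) hM1 hL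
  have hsub : N ≤ L * (M * N) := by
    calc N = 1 * (1 * N) := by ring
      _ ≤ L * (M * N) := Nat.mul_le_mul hL (Nat.mul_le_mul_right N hM1)
  have hpk' : L * (N * N) + L * (M * N) ≤ Fintype.card H + N := by omega
  have hR : (L : ℝ) * (N * N) + L * (M * N) ≤ Fintype.card H + N := by exact_mod_cast hpk'
  have hLpos : (0 : ℝ) < L := by exact_mod_cast (by omega : 0 < L)
  have hL1 : (1 : ℝ) ≤ L := by exact_mod_cast hL
  have hNpos : (0 : ℝ) < N := by exact_mod_cast (by omega : 0 < N)
  have key : (L : ℝ) * N * (N + M) ≤ L * N * (N * (N : ℝ) ^ η + 1) := by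
    calc (L : ℝ) * N * (N + M) = L * (N * N) + L * (M * N) := by ring
      _ ≤ Fintype.card H + N := hR
      _ ≤ L * (N : ℝ) ^ (2 + η) + N := by linarith
      _ = L * N * (N * (N : ℝ) ^ η) + N := by rw [Real.rpow_add hNpos, Real.rpow_two]; ring
      _ ≤ L * N * (N * (N : ℝ) ^ η) + L * N := by
          have : (N : ℝ) ≤ L * N := le_mul_of_one_le_left hNpos.le hL1
          linarith
      _ = L * N * (N * (N : ℝ) ^ η + 1) := by ring
  have h3 : (N : ℝ) + M ≤ N * (N : ℝ) ^ η + 1 := le_of_mul_le_mul_left key (mul_pos hLpos hNpos)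
  linarith

end Quantitative

end Summit.MatrixMultiplication.MatrixMultiplication.Theorems.ThinPackings.Negative
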